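import Mathlib

/-!
# MatrixMultiplication / ShapeSubmodularity — `ShapeSubmodular`, Topkis local-to-global on `ℕ³`

Crux `ShapeSubmodular` (stmt-MatrixMultiplication-15622), line `registered` (birth skeleton
`Cruxes/ShapeSubmodular/Lines/birth.lean`), stub `stub_localToGlobal`.

Pure order theory (Topkis 1978, product-of-chains criterion): a real function on `ℕ³` that satisfies
the unit-square exchange law (decreasing differences on every unit cell) in each of the three
coordinate planes is submodular on the lattice `(ℕ³, max, min)`:
`f (p ⊔ q) + f (p ⊓ q) ≤ f p + f q`.

Proof: telescoping the unit-square law gives the rectangle law in each coordinate plane; after a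
case split on the three coordinate orders, every mixed case is the sum of two rectangle laws in two
different planes, and the comparable cases are equalities.
-/

-- the tree's namespace `Summit.MatrixMultiplication.MatrixMultiplication.…` repeats a component by
-- design
set_option linter.dupNamespace false

namespace Summit.MatrixMultiplication.MatrixMultiplication.Theorems.ShapeSubmodular

/-- Rectangle law from the unit-square law on `ℕ²`: if `g` has decreasing differences on every unit
cell, then `g (a + k) (b + l) + g a b ≤ g (a + k) b + g a (b + l)` (telescoping over unit cells).
[folklore] -/
theorem rect_of_unitSquare (g : ℕ → ℕ → ℝ)
    (hg : ∀ a b : ℕ, g (a + 1) (b + 1) + g a b ≤ g (a + 1) b + g a (b + 1))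
    (a b k l : ℕ) : g (a + k) (b + l) + g a b ≤ g (a + k) b + g a (b + l) := by
  -- stack unit cells along the second coordinate (strips of width one)
  have strip : ∀ a b l : ℕ, g (a + 1) (b + l) + g a b ≤ g (a + 1) b + g a (b + l) := by
    intro a b l
    induction l with
    | zero => simp
    | succ l ih =>
      have h := hg a (b + l)
      rw [← add_assoc]
      linarith
  -- stack the strips along the first coordinate
  induction k with
  | zero =>
    simp only [add_zero]
    linarith
  | succ k ih =>
    have h := strip (a + k) b l
    rw [← add_assoc]
    linarith

/-- Rectangle law in `≤` form: decreasing differences on unit cells of `ℕ²` give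
`g a' b' + g a b ≤ g a' b + g a b'` whenever `a ≤ a'` and `b ≤ b'`. [folklore] -/
theorem rect_of_unitSquare_le (g : ℕ → ℕ → ℝ)
    (hg : ∀ a b : ℕ, g (a + 1) (b + 1) + g a b ≤ g (a + 1) b + g a (b + 1))
    {a a' b b' : ℕ} (ha : a ≤ a') (hb : b ≤ b') :
    g a' b' + g a b ≤ g a' b + g a b' := by
  obtain ⟨k, rfl⟩ := Nat.exists_eq_add_of_le ha
  obtain ⟨l, rfl⟩ := Nat.exists_eq_add_of_le hb
  exact rect_of_unitSquare g hg a b k l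

/-- **Topkis' local-to-global criterion on `ℕ³`** (Topkis 1978, §3, product of chains): a real
function on `ℕ³` with decreasing differences on every unit square of each of the three coordinate
planes is submodular on the lattice `(ℕ³, max, min)`, i.e.
`f (p ⊔ q) + f (p ⊓ q) ≤ f p + f q` for all `p q : ℕ³`. (Topkis 1978) -/
theorem stub_localToGlobal :
    ∀ f : ℕ → ℕ → ℕ → ℝ,
      (∀ a b c : ℕ, f (a + 1) (b + 1) c + f a b c ≤ f (a + 1) b c + f a (b + 1) c) →
      (∀ a b c : ℕ, f a (b + 1) (c + 1) + f a b c ≤ f a (b + 1) c + f a b (c + 1)) →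
      (∀ a b c : ℕ, f (a + 1) b (c + 1) + f a b c ≤ f (a + 1) b c + f a b (c + 1)) →
      ∀ a b c a' b' c' : ℕ,
        f (max a a') (max b b') (max c c') + f (min a a') (min b b') (min c c') ≤
          f a b c + f a' b' c' := by
  intro f h12 h23 h13 a b c a' b' c'
  -- the rectangle laws in the three coordinate planes, in `≤` form
  have r12 : ∀ (z : ℕ) {x x' y y' : ℕ}, x ≤ x' → y ≤ y' →
      f x' y' z + f x y z ≤ f x' y z + f x y' z :=
    fun z _ _ _ _ hx hy => rect_of_unitSquare_le (fun x y => f x y z) (fun x y => h12 x y z) hx hy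
  have r23 : ∀ (x : ℕ) {y y' z z' : ℕ}, y ≤ y' → z ≤ z' →
      f x y' z' + f x y z ≤ f x y' z + f x y z' :=
    fun x _ _ _ _ hy hz => rect_of_unitSquare_le (fun y z => f x y z) (fun y z => h23 x y z) hy hz
  have r13 : ∀ (y : ℕ) {x x' z z' : ℕ}, x ≤ x' → z ≤ z' →
      f x' y z' + f x y z ≤ f x' y z + f x y z' :=
    fun y _ _ _ _ hx hz => rect_of_unitSquare_le (fun x z => f x y z) (fun x z => h13 x y z) hx hz
  rcases le_total a a' with h₁ | h₁ <;> rcases le_total b b' with h₂ | h₂ <;>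
    rcases le_total c c' with h₃ | h₃
  · -- `a ≤ a'`, `b ≤ b'`, `c ≤ c'`: comparable points, equality
    rw [max_eq_right h₁, max_eq_right h₂, max_eq_right h₃, min_eq_left h₁, min_eq_left h₂,
      min_eq_left h₃]
    linarith
  · -- `a ≤ a'`, `b ≤ b'`, `c' ≤ c`: planes (2,3) and (1,3)
    rw [max_eq_right h₁, max_eq_right h₂, max_eq_left h₃, min_eq_left h₁, min_eq_left h₂,
      min_eq_right h₃]
    linarith [r23 a' h₂ h₃, r13 b h₁ h₃]
  · -- `a ≤ a'`, `b' ≤ b`, `c ≤ c'`: planes (1,2) and (2,3)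
    rw [max_eq_right h₁, max_eq_left h₂, max_eq_right h₃, min_eq_left h₁, min_eq_right h₂,
      min_eq_left h₃]
    linarith [r12 c' h₁ h₂, r23 a h₂ h₃]
  · -- `a ≤ a'`, `b' ≤ b`, `c' ≤ c`: planes (1,2) and (1,3)
    rw [max_eq_right h₁, max_eq_left h₂, max_eq_left h₃, min_eq_left h₁, min_eq_right h₂,
      min_eq_right h₃]
    linarith [r12 c h₁ h₂, r13 b' h₁ h₃]
  · -- `a' ≤ a`, `b ≤ b'`, `c ≤ c'`: planes (1,2) and (1,3)
    rw [max_eq_left h₁, max_eq_right h₂, max_eq_right h₃, min_eq_right h₁, min_eq_left h₂,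
      min_eq_left h₃]
    linarith [r12 c' h₁ h₂, r13 b h₁ h₃]
  · -- `a' ≤ a`, `b ≤ b'`, `c' ≤ c`: planes (1,2) and (2,3)
    rw [max_eq_left h₁, max_eq_right h₂, max_eq_left h₃, min_eq_right h₁, min_eq_left h₂,
      min_eq_right h₃]
    linarith [r12 c h₁ h₂, r23 a' h₂ h₃]
  · -- `a' ≤ a`, `b' ≤ b`, `c ≤ c'`: planes (1,3) and (2,3)
    rw [max_eq_left h₁, max_eq_left h₂, max_eq_right h₃, min_eq_right h₁, min_eq_right h₂,
      min_eq_left h₃]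
    linarith [r13 b h₁ h₃, r23 a' h₂ h₃]
  · -- `a' ≤ a`, `b' ≤ b`, `c' ≤ c`: comparable points, equality
    rw [max_eq_left h₁, max_eq_left h₂, max_eq_left h₃, min_eq_right h₁, min_eq_right h₂,
      min_eq_right h₃]

end Summit.MatrixMultiplication.MatrixMultiplication.Theorems.ShapeSubmodular
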